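import Mathlib
import HarnessLib
import Summits.AtomisticToContinuum.FouriersLaw.Theses.JunctionLocality
import Summits.AtomisticToContinuum.FouriersLaw.Theorems.JunctionLocalityConductanceLowerBoundStubRowSum
import Summits.AtomisticToContinuum.FouriersLaw.Theorems.JunctionLocalitySuperadditiveResistanceKuboDirichlet

/-!
# Contact formation, III: Gaussian pairings under the Gibbs state (the analytic half of the curl certificate)

Helper file (`--supports` stmt-AtomisticToContinuum-11749) for stub `stub_contactFormation` (R4) of the line
`cold-bath-relocation-walk` of the crux `JunctionLocality.ConductanceLowerBound` (lead c2 worker). This part is ABSTRACT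
measure theory on `L²(μ_T)` of the pinned chain `pinnedChain ω₂ lam β γ` (`ω₂ > 0`, `lam, β ≥ 0`, `T > 0`), independent of
the particular test function of the certificate:

* `contact_integral_snd_mul` — Gaussian integration by parts in ONE momentum, `∫ p_j u dμ_T = T ∫ ∂_{p_j} u dμ_T`, for a
  differentiable `u` with `u, p_j u, ∂_{p_j} u ∈ L¹(μ_T)` (no support or growth condition);
* `contact_integral_eq_zero_of_odd` — an integrand odd under momentum reversal has integral zero;
* `contact_dirichlet` — the carré-du-champ identity with the energy cutoff removed, for GENERAL site weights `B ≥ 0` and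
  friction `c > 0`: `∫ u k ρ_T = cT Σ_i B_i ∫ (∂_{p_i}u)² ρ_T` for a `C² ∩ L²` solution of `σX_H u + cS_B u = −k`, `k ∈ L²`
  (adapted from `integral_mul_source_eq_dirichlet'`, which is the case `B = bathWeight`);
* `contact_cross` — the cutoff-removed cross identity `integral_cross_eq` in Gibbs-MEASURE form;
* `contact_integral_mul_twoMomenta` — the certificate's pairing step: if `∂_{p_a}A = W = ∂_{p_b}A'` then
  `∫ g (p_a A − p_b A') dμ_T = T(⟨∂_{p_a}g, A⟩ − ⟨∂_{p_b}g, A'⟩)` (the two `∫ gW` terms CANCEL — this is where the curl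
  identity `∂_{q_0}F_1 = ∂_{q_1}F_0` is consumed), registered as `contact_twoMomentaPairing`;
* `contact_sq_add_integral_mul_le` — the two-term Cauchy–Schwarz inequality `(⟨u₁,v₁⟩ + ⟨u₂,v₂⟩)² ≤ (‖u₁‖²+‖u₂‖²)(‖v₁‖²+‖v₂‖²)`.

References: Eckmann–Pillet–Rey-Bellet 1999 §3 (entropy production identity); folklore.
-/

noncomputable section

open MeasureTheory Filter Topology
open scoped ContDiff
open Literature.MathematicalPhysics.KineticTheory.HeatConduction
open Summit.AtomisticToContinuum.FouriersLaw.Theorems.SuperadditiveResistance.DeviceLiouville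
  (kin kin_eq_sq liouvilleOp bathOp partialP_mul)
open Summit.AtomisticToContinuum.FouriersLaw.Theorems.SuperadditiveResistance.Kubo
  (chi dirichlet_level tendsto_integral_chi_mul tendsto_integral_partialP_chi_mul memLp_partialP
    integrable_mul_gibbsDensity_iff integrable_mul_mul_gibbsDensity integrable_sq_mul_gibbsDensity continuous_source)
open Summit.AtomisticToContinuum.FouriersLaw.Cruxes.SuperadditiveResistance.FloatingProbeBypassLaplacian
  (abs_integral_mul_le integrable_mul_gibbsDensity_of_integrable)
open Summit.AtomisticToContinuum.FouriersLaw.Cruxes.ConductanceLowerBound.ForecastSensitivity (integral_cross_eq)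

namespace Summit.AtomisticToContinuum.FouriersLaw.Cruxes.ConductanceLowerBound.ColdBathRelocationWalk

variable {ω₂ lam β : ℝ} {L : ℕ}

/-! ## Gaussian integration by parts in one momentum, and odd integrands -/

/-- **Gaussian integration by parts in the momentum `p_j` under `μ_T`**: for a differentiable `u` with
`u, p_j u, ∂_{p_j} u ∈ L¹(μ_T)`, `∫ p_j u dμ_T = T ∫ ∂_{p_j} u dμ_T` (`p_j e^{−H/T} = −T ∂_{p_j} e^{−H/T}` and Mathlib's
integration by parts for integrable products along `(0, e_j)`; no support or growth condition). [folklore] -/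
theorem contact_integral_snd_mul (hω : 0 < ω₂) (hl : 0 ≤ lam) (hβ : 0 ≤ β) (γ : ℝ) (L : ℕ) {T : ℝ} (hT : 0 < T)
    (j : Fin L) {u : PhaseSpace L → ℝ} (hu : Differentiable ℝ u)
    (hu1 : Integrable u ((pinnedChain ω₂ lam β γ).gibbsMeasure L T))
    (hpu : Integrable (fun x => x.2 j * u x) ((pinnedChain ω₂ lam β γ).gibbsMeasure L T))
    (hdu : Integrable (partialP j u) ((pinnedChain ω₂ lam β γ).gibbsMeasure L T)) :
    ∫ x, x.2 j * u x ∂((pinnedChain ω₂ lam β γ).gibbsMeasure L T) =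
      T * ∫ x, partialP j u x ∂((pinnedChain ω₂ lam β γ).gibbsMeasure L T) := by
  -- adapted from `IncoherentBounded.integral_snd_mul_eq_integral_partialP` (boundedness replaced by integrability)
  set P := pinnedChain ω₂ lam β γ with hP
  have i0 := integrable_mul_gibbsDensity_of_integrable hω hl hβ γ L hT hu1
  have i1 := integrable_mul_gibbsDensity_of_integrable hω hl hβ γ L hT hpu
  have i2 := integrable_mul_gibbsDensity_of_integrable hω hl hβ γ L hT hdu
  haveI := isAddHaarMeasure_volume_phaseSpace L
  have e := integral_bilinear_hasLineDerivAt_right_eq_neg_left_of_integrable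
    (μ := (volume : Measure (PhaseSpace L))) (B := ContinuousLinearMap.mul ℝ ℝ)
    (f := u) (f' := partialP j u) (g := P.gibbsDensity L T)
    (g' := fun x => -(x.2 j / T) * P.gibbsDensity L T x)
    (v := ((0, Pi.single j 1) : PhaseSpace L)) ?_ ?_ ?_ (fun x _ => hasLineDerivAt_partialP hu j x)
    (fun x _ => P.hasLineDerivAt_gibbsDensity (P.hasLineDerivAt_hamiltonian_unitP L x j))
  · simp only [ContinuousLinearMap.mul_apply'] at e
    have e1 : ∫ x, u x * (-(x.2 j / T) * P.gibbsDensity L T x) =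
        -T⁻¹ * ∫ x, x.2 j * u x * P.gibbsDensity L T x := by
      rw [← integral_const_mul]
      refine integral_congr_ae (ae_of_all _ fun x => ?_)
      simp only
      field_simp
    rw [e1] at e
    have e2 : ∫ x, x.2 j * u x * P.gibbsDensity L T x = T * ∫ x, partialP j u x * P.gibbsDensity L T x := by
      have hTT : T * T⁻¹ = 1 := mul_inv_cancel₀ hT.ne'
      calc ∫ x, x.2 j * u x * P.gibbsDensity L T x
          = -T * (-T⁻¹ * ∫ x, x.2 j * u x * P.gibbsDensity L T x) := by
            rw [← mul_assoc, show -T * -T⁻¹ = T * T⁻¹ by ring, hTT, one_mul]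
        _ = -T * -∫ x, partialP j u x * P.gibbsDensity L T x := by rw [e]
        _ = T * ∫ x, partialP j u x * P.gibbsDensity L T x := by ring
    rw [P.integral_gibbsMeasure, P.integral_gibbsMeasure, e2]
    ring
  · simp only [ContinuousLinearMap.mul_apply']
    exact i2
  · simp only [ContinuousLinearMap.mul_apply']
    have : Integrable (fun x => -T⁻¹ * (x.2 j * u x * P.gibbsDensity L T x)) := i1.const_mul _
    refine this.congr (ae_of_all _ fun x => ?_)
    simp only
    field_simp
  · simp only [ContinuousLinearMap.mul_apply']
    exact i0

/-- **Odd integrands vanish**: if `ψ(q, −p) = −ψ(q, p)` then `∫ ψ dμ_T = 0` for the Gibbs measure of any chain (momentum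
reversal preserves `e^{−H/T} dq dp`; no integrability needed). [folklore] -/
theorem contact_integral_eq_zero_of_odd (P : OscillatorChain) (L : ℕ) (T : ℝ) {ψ : PhaseSpace L → ℝ}
    (hψ : ∀ x : PhaseSpace L, ψ (x.1, -x.2) = -ψ x) :
    ∫ x, ψ x ∂(P.gibbsMeasure L T) = 0 := by
  -- adapted from `pinnedChain_integral_bondCurrent_gibbsMeasure`
  rw [P.integral_gibbsMeasure]
  have h := integral_comp_momentumReversal L fun x => ψ x * P.gibbsDensity L T x
  simp only [hψ, OscillatorChain.gibbsDensity, OscillatorChain.hamiltonian_neg_momentum, neg_mul, integral_neg] at h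
  have h0 : ∫ x, ψ x * P.gibbsDensity L T x = 0 := by
    simp only [OscillatorChain.gibbsDensity]
    linarith
  rw [h0, mul_zero]

/-! ## The Dirichlet identity and the cross identity, cutoff removed, general site weights -/

/-- **Carré du champ, cutoff removed, general weights.** For the pinned chain (`ω₂ > 0`, `lam, β ≥ 0`), `T > 0`, weights
`B ≥ 0`, friction `c > 0` and a classical solution `u ∈ C² ∩ L²(μ_T)` of `σX_H u + cS_B u = −k` with `k ∈ L²(μ_T)`:
`∫ u k e^{−H/T} = c T Σ_i B_i ∫ (∂_{p_i} u)² e^{−H/T}` — the `n → ∞` limit of `Kubo.dirichlet_level` (`χ_n → 1`; the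
cutoff-gradient terms vanish by dominated convergence since `∂_{p_i} u ∈ L²(μ_T)` wherever `B_i > 0`, `Kubo.memLp_partialP`).
[folklore] -/
theorem contact_dirichlet (hω : 0 < ω₂) (hl : 0 ≤ lam) (hβ : 0 ≤ β) (γ : ℝ) (L : ℕ) {T : ℝ} (hT : 0 < T)
    (B : Fin L → ℝ) (hB : ∀ i, 0 ≤ B i) (σ : ℝ) {c : ℝ} (hc : 0 < c) {u k : PhaseSpace L → ℝ} (hu : ContDiff ℝ 2 u)
    (hu2 : MemLp u 2 ((pinnedChain ω₂ lam β γ).gibbsMeasure L T))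
    (hk2 : MemLp k 2 ((pinnedChain ω₂ lam β γ).gibbsMeasure L T))
    (hpde : ∀ x, σ * liouvilleOp (pinnedChain ω₂ lam β γ) L u x + c * bathOp L B T u x = -k x) :
    ∫ x, u x * k x * (pinnedChain ω₂ lam β γ).gibbsDensity L T x =
      c * T * ∑ i : Fin L, B i * ∫ x, partialP i u x ^ 2 * (pinnedChain ω₂ lam β γ).gibbsDensity L T x := by
  -- adapted from `ForecastSensitivity.integral_mul_source_eq_dirichlet'` (`B`, `σ`, `c` free)
  set P := pinnedChain ω₂ lam β γ with hP
  have hu1 : ContDiff ℝ 1 u := hu.of_le (by norm_cast)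
  have huc : Continuous u := hu.continuous
  have hkc : Continuous k := continuous_source B T σ c hu hpde
  have hduc : ∀ i, Continuous (partialP i u) := fun i => continuous_partialP hu1 one_ne_zero i
  have hlevel : ∀ n : ℕ, (∫ x, chi P L n x * u x * k x * P.gibbsDensity L T x) -
      c * T * ∑ i, B i * ∫ x, u x * partialP i (chi P L n) x * partialP i u x * P.gibbsDensity L T x =
      c * T * ∑ i, B i * ∫ x, chi P L n x * partialP i u x ^ 2 * P.gibbsDensity L T x :=
    fun n => (dirichlet_level hω hl hβ γ L hT B σ c hu hpde n).symm
  have hdu2 : ∀ {i : Fin L}, 0 < B i → MemLp (partialP i u) 2 (P.gibbsMeasure L T) := fun {i} hi =>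
    memLp_partialP hω hl hβ γ L hT B hB σ hc hu hu2 hk2 hpde hi
  have hukL1 : Integrable fun x => u x * k x * P.gibbsDensity L T x :=
    integrable_mul_mul_gibbsDensity hω hl hβ γ L hT hu2 hk2
  have hlim1 : Tendsto (fun n : ℕ => ∫ x, chi P L n x * u x * k x * P.gibbsDensity L T x) atTop
      (𝓝 (∫ x, u x * k x * P.gibbsDensity L T x)) := by
    refine (tendsto_integral_chi_mul hω.le hl hβ γ L T (F := fun x => u x * k x)
      (huc.mul hkc).aestronglyMeasurable hukL1).congr fun n => ?_
    exact integral_congr_ae (ae_of_all _ fun x => by ring)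
  have hlimE : ∀ i : Fin L, Tendsto (fun n : ℕ => B i * ∫ x, u x * partialP i (chi P L n) x *
      partialP i u x * P.gibbsDensity L T x) atTop (𝓝 0) := by
    intro i
    rcases (hB i).eq_or_lt with hi | hi
    · rw [← hi]
      simp only [zero_mul]
      exact tendsto_const_nhds
    · have hF : Integrable fun x => u x * partialP i u x * P.gibbsDensity L T x :=
        integrable_mul_mul_gibbsDensity hω hl hβ γ L hT hu2 (hdu2 hi)
      have h0 := tendsto_integral_partialP_chi_mul hω hl hβ γ L T i (F := fun x => u x * partialP i u x)
        (huc.mul (hduc i)).aestronglyMeasurable hF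
      have h1 := h0.const_mul (B i)
      rw [mul_zero] at h1
      refine h1.congr fun n => ?_
      congr 1
      exact integral_congr_ae (ae_of_all _ fun x => by ring)
  have hlimD : ∀ i : Fin L, Tendsto (fun n : ℕ => B i * ∫ x, chi P L n x * partialP i u x ^ 2 *
      P.gibbsDensity L T x) atTop (𝓝 (B i * ∫ x, partialP i u x ^ 2 * P.gibbsDensity L T x)) := by
    intro i
    rcases (hB i).eq_or_lt with hi | hi
    · rw [← hi]
      simp only [zero_mul]
      exact tendsto_const_nhds
    · have hF : Integrable fun x => partialP i u x ^ 2 * P.gibbsDensity L T x :=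
        integrable_sq_mul_gibbsDensity hω hl hβ γ L hT (hdu2 hi)
      exact (tendsto_integral_chi_mul hω.le hl hβ γ L T (F := fun x => partialP i u x ^ 2)
        ((hduc i).pow 2).aestronglyMeasurable hF).const_mul (B i)
  have hLlim : Tendsto (fun n : ℕ => (∫ x, chi P L n x * u x * k x * P.gibbsDensity L T x) -
      c * T * ∑ i, B i * ∫ x, u x * partialP i (chi P L n) x * partialP i u x * P.gibbsDensity L T x)
      atTop (𝓝 ((∫ x, u x * k x * P.gibbsDensity L T x) - c * T * 0)) := by
    have hs := tendsto_finsetSum (Finset.univ : Finset (Fin L)) fun i _ => hlimE i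
    rw [Finset.sum_const_zero] at hs
    exact hlim1.sub (hs.const_mul (c * T))
  have hR : Tendsto (fun n : ℕ => c * T * ∑ i, B i * ∫ x, chi P L n x * partialP i u x ^ 2 *
      P.gibbsDensity L T x) atTop
      (𝓝 (c * T * ∑ i, B i * ∫ x, partialP i u x ^ 2 * P.gibbsDensity L T x)) :=
    (tendsto_finsetSum (Finset.univ : Finset (Fin L)) fun i _ => hlimD i).const_mul (c * T)
  have heq := tendsto_nhds_unique (hLlim.congr hlevel) hR
  rw [mul_zero, sub_zero] at heq
  exact heq

/-- **Cross identity in Gibbs-measure form.** For weights `B ≥ 0`, friction `c > 0`, a forward pair `X_H f + cS_B f = −k_f`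
and a backward pair `−X_H h + cS_B h = −k_h` with `f, h ∈ C² ∩ L²(μ_T)`, `k_f, k_h ∈ L²(μ_T)`:
`∫ h k_f dμ_T = ∫ f k_h dμ_T` (`integral_cross_eq` divided by the partition function). [folklore] -/
theorem contact_cross (hω : 0 < ω₂) (hl : 0 ≤ lam) (hβ : 0 ≤ β) (γ : ℝ) (L : ℕ) {T : ℝ} (hT : 0 < T)
    (B : Fin L → ℝ) (hB : ∀ i, 0 ≤ B i) {c : ℝ} (hc : 0 < c) {f kf h kh : PhaseSpace L → ℝ}
    (hf : ContDiff ℝ 2 f) (hh : ContDiff ℝ 2 h)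
    (hf2 : MemLp f 2 ((pinnedChain ω₂ lam β γ).gibbsMeasure L T))
    (hkf2 : MemLp kf 2 ((pinnedChain ω₂ lam β γ).gibbsMeasure L T))
    (hh2 : MemLp h 2 ((pinnedChain ω₂ lam β γ).gibbsMeasure L T))
    (hkh2 : MemLp kh 2 ((pinnedChain ω₂ lam β γ).gibbsMeasure L T))
    (hpf : ∀ x, 1 * liouvilleOp (pinnedChain ω₂ lam β γ) L f x + c * bathOp L B T f x = -kf x)
    (hph : ∀ x, -1 * liouvilleOp (pinnedChain ω₂ lam β γ) L h x + c * bathOp L B T h x = -kh x) :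
    ∫ x, h x * kf x ∂((pinnedChain ω₂ lam β γ).gibbsMeasure L T) =
      ∫ x, f x * kh x ∂((pinnedChain ω₂ lam β γ).gibbsMeasure L T) := by
  rw [(pinnedChain ω₂ lam β γ).integral_gibbsMeasure, (pinnedChain ω₂ lam β γ).integral_gibbsMeasure,
    integral_cross_eq hω hl hβ L hT B hB 1 hc hf hh hf2 hkf2 hh2 hkh2 hpf hph]

/-! ## The pairing step of the certificate: two momenta, cancelling position terms -/

/-- **Two-momenta pairing with a curl-free pair of coefficients.** For the pinned chain's Gibbs state, sites `a, b`,
`g ∈ C²` with `g, ∂_{p_a}g, ∂_{p_b}g ∈ L²(μ_T)`, and differentiable coefficients `A, A'` with the SAME momentum derivative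
`∂_{p_a}A = W = ∂_{p_b}A'` and `A, A', p_aA, p_bA', W ∈ L²(μ_T)`:
`∫ g (p_a A − p_b A') dμ_T = T (∫ ∂_{p_a}g · A dμ_T − ∫ ∂_{p_b}g · A' dμ_T)` — one Gaussian integration by parts in each
momentum; the two position terms `T∫ gW` cancel. In the certificate `A = γF_1 + X_H F_1`, `A' = γF_0 + X_H F_0`,
`W = V''(q_1 − q_0)` by the curl identity. [folklore] -/
theorem contact_integral_mul_twoMomenta (hω : 0 < ω₂) (hl : 0 ≤ lam) (hβ : 0 ≤ β) (γ : ℝ) (L : ℕ) {T : ℝ}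
    (hT : 0 < T) (a b : Fin L) {g A A' W : PhaseSpace L → ℝ} (hg : ContDiff ℝ 2 g) (hA : Differentiable ℝ A)
    (hA' : Differentiable ℝ A') (hWa : ∀ x, partialP a A x = W x) (hWb : ∀ x, partialP b A' x = W x)
    (hg2 : MemLp g 2 ((pinnedChain ω₂ lam β γ).gibbsMeasure L T))
    (hga : MemLp (partialP a g) 2 ((pinnedChain ω₂ lam β γ).gibbsMeasure L T))
    (hgb : MemLp (partialP b g) 2 ((pinnedChain ω₂ lam β γ).gibbsMeasure L T))
    (hA2 : MemLp A 2 ((pinnedChain ω₂ lam β γ).gibbsMeasure L T))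
    (hA'2 : MemLp A' 2 ((pinnedChain ω₂ lam β γ).gibbsMeasure L T))
    (hpA : MemLp (fun x => x.2 a * A x) 2 ((pinnedChain ω₂ lam β γ).gibbsMeasure L T))
    (hpA' : MemLp (fun x => x.2 b * A' x) 2 ((pinnedChain ω₂ lam β γ).gibbsMeasure L T))
    (hW2 : MemLp W 2 ((pinnedChain ω₂ lam β γ).gibbsMeasure L T)) :
    ∫ x, g x * (x.2 a * A x - x.2 b * A' x) ∂((pinnedChain ω₂ lam β γ).gibbsMeasure L T) =
      T * ((∫ x, partialP a g x * A x ∂((pinnedChain ω₂ lam β γ).gibbsMeasure L T)) -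
        ∫ x, partialP b g x * A' x ∂((pinnedChain ω₂ lam β γ).gibbsMeasure L T)) := by
  set μ := (pinnedChain ω₂ lam β γ).gibbsMeasure L T with hμ
  have hgd : Differentiable ℝ g := hg.differentiable two_ne_zero
  -- the two products `u = gA`, `u' = gA'` and their momentum derivatives
  have hu : Differentiable ℝ fun y => g y * A y := hgd.mul hA
  have hu' : Differentiable ℝ fun y => g y * A' y := hgd.mul hA'
  have hdu : ∀ x, partialP a (fun y => g y * A y) x = partialP a g x * A x + g x * W x := fun x => by
    rw [partialP_mul hgd hA, hWa]
  have hdu' : ∀ x, partialP b (fun y => g y * A' y) x = partialP b g x * A' x + g x * W x := fun x => by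
    rw [partialP_mul hgd hA', hWb]
  -- integrability
  have i1 : Integrable (fun x => g x * A x) μ := hg2.integrable_mul hA2
  have i1' : Integrable (fun x => g x * A' x) μ := hg2.integrable_mul hA'2
  have i2'' : Integrable (fun x => g x * (x.2 a * A x)) μ := hg2.integrable_mul hpA
  have i2 : Integrable (fun x => x.2 a * (g x * A x)) μ := i2''.congr (ae_of_all _ fun x => by ring)
  have i2''' : Integrable (fun x => g x * (x.2 b * A' x)) μ := hg2.integrable_mul hpA'
  have i2' : Integrable (fun x => x.2 b * (g x * A' x)) μ := i2'''.congr (ae_of_all _ fun x => by ring)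
  have i3a : Integrable (fun x => partialP a g x * A x) μ := hga.integrable_mul hA2
  have i3b : Integrable (fun x => partialP b g x * A' x) μ := hgb.integrable_mul hA'2
  have i4 : Integrable (fun x => g x * W x) μ := hg2.integrable_mul hW2
  have i5 : Integrable (partialP a fun y => g y * A y) μ :=
    (i3a.add i4).congr (ae_of_all _ fun x => (hdu x).symm)
  have i5' : Integrable (partialP b fun y => g y * A' y) μ :=
    (i3b.add i4).congr (ae_of_all _ fun x => (hdu' x).symm)
  -- one Gaussian integration by parts in each momentum
  have ea := contact_integral_snd_mul hω hl hβ γ L hT a hu i1 i2 i5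
  have eb := contact_integral_snd_mul hω hl hβ γ L hT b hu' i1' i2' i5'
  rw [integral_congr_ae (ae_of_all _ fun x => hdu x), integral_add i3a i4] at ea
  rw [integral_congr_ae (ae_of_all _ fun x => hdu' x), integral_add i3b i4] at eb
  have hsplit : ∫ x, g x * (x.2 a * A x - x.2 b * A' x) ∂μ =
      (∫ x, x.2 a * (g x * A x) ∂μ) - ∫ x, x.2 b * (g x * A' x) ∂μ := by
    rw [← integral_sub i2 i2']
    exact integral_congr_ae (ae_of_all _ fun x => by ring)
  rw [hsplit, ea, eb]
  ring

/-! ## Two-term Cauchy–Schwarz -/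

/-- **Two-term Cauchy–Schwarz in `L²(μ)`**: `(∫u₁v₁ + ∫u₂v₂)² ≤ (∫u₁² + ∫u₂²)(∫v₁² + ∫v₂²)`. [folklore] -/
theorem contact_sq_add_integral_mul_le {α : Type*} [MeasurableSpace α] {μ : Measure α} {u₁ v₁ u₂ v₂ : α → ℝ}
    (hu₁ : MemLp u₁ 2 μ) (hv₁ : MemLp v₁ 2 μ) (hu₂ : MemLp u₂ 2 μ) (hv₂ : MemLp v₂ 2 μ) :
    ((∫ x, u₁ x * v₁ x ∂μ) + ∫ x, u₂ x * v₂ x ∂μ) ^ 2 ≤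
      ((∫ x, u₁ x ^ 2 ∂μ) + ∫ x, u₂ x ^ 2 ∂μ) * ((∫ x, v₁ x ^ 2 ∂μ) + ∫ x, v₂ x ^ 2 ∂μ) := by
  have h1 := abs_integral_mul_le hu₁ hv₁
  have h2 := abs_integral_mul_le hu₂ hv₂
  set a := Real.sqrt (∫ x, u₁ x ^ 2 ∂μ) with ha
  set b := Real.sqrt (∫ x, v₁ x ^ 2 ∂μ) with hb
  set c := Real.sqrt (∫ x, u₂ x ^ 2 ∂μ) with hc
  set d := Real.sqrt (∫ x, v₂ x ^ 2 ∂μ) with hd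
  have hU₁ : 0 ≤ ∫ x, u₁ x ^ 2 ∂μ := integral_nonneg fun x => sq_nonneg _
  have hV₁ : 0 ≤ ∫ x, v₁ x ^ 2 ∂μ := integral_nonneg fun x => sq_nonneg _
  have hU₂ : 0 ≤ ∫ x, u₂ x ^ 2 ∂μ := integral_nonneg fun x => sq_nonneg _
  have hV₂ : 0 ≤ ∫ x, v₂ x ^ 2 ∂μ := integral_nonneg fun x => sq_nonneg _
  rw [← Real.sq_sqrt hU₁, ← Real.sq_sqrt hV₁, ← Real.sq_sqrt hU₂, ← Real.sq_sqrt hV₂]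
  have ha0 : 0 ≤ a := Real.sqrt_nonneg _
  have hb0 : 0 ≤ b := Real.sqrt_nonneg _
  have hc0 : 0 ≤ c := Real.sqrt_nonneg _
  have hd0 : 0 ≤ d := Real.sqrt_nonneg _
  have hI : |(∫ x, u₁ x * v₁ x ∂μ) + ∫ x, u₂ x * v₂ x ∂μ| ≤ a * b + c * d :=
    (abs_add_le _ _).trans (add_le_add h1 h2)
  have hsq : ((∫ x, u₁ x * v₁ x ∂μ) + ∫ x, u₂ x * v₂ x ∂μ) ^ 2 ≤ (a * b + c * d) ^ 2 := by
    rw [← sq_abs]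
    exact pow_le_pow_left₀ (abs_nonneg _) hI 2
  calc ((∫ x, u₁ x * v₁ x ∂μ) + ∫ x, u₂ x * v₂ x ∂μ) ^ 2 ≤ (a * b + c * d) ^ 2 := hsq
    _ ≤ (a ^ 2 + c ^ 2) * (b ^ 2 + d ^ 2) := by nlinarith [sq_nonneg (a * d - c * b)]

/-- **Registered helper `contact_twoMomentaPairing` (R4 `stub_contactFormation`, line `cold-bath-relocation-walk`;
= `contact_integral_mul_twoMomenta` in stub form): the pairing step of the curl certificate.** [folklore] -/
theorem contact_twoMomentaPairing : ∀ {ω₂ lam β : ℝ}, 0 < ω₂ → 0 ≤ lam → 0 ≤ β → ∀ (γ : ℝ) (L : ℕ) {T : ℝ}, 0 < T → ∀ (a b : Fin L) {g A A' W : PhaseSpace L → ℝ}, ContDiff ℝ 2 g → Differentiable ℝ A → Differentiable ℝ A' → (∀ x, partialP a A x = W x) → (∀ x, partialP b A' x = W x) → MemLp g 2 ((pinnedChain ω₂ lam β γ).gibbsMeasure L T) → MemLp (partialP a g) 2 ((pinnedChain ω₂ lam β γ).gibbsMeasure L T) → MemLp (partialP b g) 2 ((pinnedChain ω₂ lam β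 γ).gibbsMeasure L T) → MemLp A 2 ((pinnedChain ω₂ lam β γ).gibbsMeasure L T) → MemLp A' 2 ((pinnedChain ω₂ lam β γ).gibbsMeasure L T) → MemLp (fun x => x.2 a * A x) 2 ((pinnedChain ω₂ lam β γ).gibbsMeasure L T) → MemLp (fun x => x.2 b * A' x) 2 ((pinnedChain ω₂ lam β γ).gibbsMeasure L T) → MemLp W 2 ((pinnedChain ω₂ lam β γ).gibbsMeasure L T) → ∫ x, g x * (x.2 a * A x - x.2 b * A' x) ∂((pinnedChain ω₂ lam β γ).gibbsMeasure L T) = T * ((∫ x, partialP a g x * A x ∂((pinnedChain ω₂ lam β γ).gibbsMeasure L T)) - ∫ x, partialP b g x * A' x ∂((pinnedChain ω₂ lam β γ).gibbsMeasure L T)) :=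
  fun hω hl hβ γ L _ hT a b _ _ _ _ hg hA hA' hWa hWb hg2 hga hgb hA2 hA'2 hpA hpA' hW2 =>
    contact_integral_mul_twoMomenta hω hl hβ γ L hT a b hg hA hA' hWa hWb hg2 hga hgb hA2 hA'2 hpA hpA' hW2

end Summit.AtomisticToContinuum.FouriersLaw.Cruxes.ConductanceLowerBound.ColdBathRelocationWalk

end
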